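import Mathlib.Analysis.SpecialFunctions.Gamma.Beta
import Mathlib.Analysis.SpecialFunctions.Pow.Real
import Mathlib.Analysis.SpecialFunctions.Trigonometric.Basic
import Mathlib.Tactic.LinearCombination
import Literature.Analysis.SpecialFunctions.GammaMultiplication
import HarnessLib

/-!
# The second `ε`-type period constant on the Fermat surface of degree 12 (proved value,
# sign, and its degree-8 minimal polynomial)

Topic: `Literature/Analysis/SpecialFunctions`. Companion of `GammaFermatSurface12Eps.lean`.
With Deligne's normalisation `Γ̃(a) = (2πi)^{-2} ∏ᵢ Γ(aᵢ/12)` (LNM 900, I §7, Thm. 7.15) the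
Hodge character class `a = (1,6,8,9)` of the degree-12 Fermat surface is the second of the two
`(ℤ/12)^×`-orbits whose symbol lies in the reflection/distribution lattice only after doubling
(2-torsion of the universal distribution; Das, Trans. AMS 352 (2000)). This file PROVES, from
Mathlib's reflection and Legendre duplication formulas and the tree's Gauss multiplication formula
(`GaussMultiplication.real_formula`, `n = 3`, `x = 1/12`):

* `(Γ(1/12) Γ(6/12) Γ(8/12) Γ(9/12))² = 4 √2 (√3 + 1) / 3^{1/4} · π⁴`;
* normalised: `Γ̃² = √2 (√3+1) / (4 · 3^{1/4})` (`= (2+√3)^{1/2} / (2 · 3^{1/4})`), and in `ℂ`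
  `Γ̃ = −√(√2(√3+1)/(4·3^{1/4}))` (the sign);
* `48 Γ̃⁸ − 24 Γ̃⁴ − 1 = 0` — the polynomial found as the exact minimal polynomial of `Γ̃` by the
  pub-hlocus engine A (PARI `minpoly` in the Kummer field); irreducibility is not asserted here.

## Sources

* P. Deligne, *Hodge cycles on abelian varieties*, LNM 900 (1982), I §7, Thm. 7.15.
* P. Das, *Algebraic Gamma monomials and double coverings of cyclotomic fields*,
  Trans. Amer. Math. Soc. 352 (2000), 3557–3594.
* G. E. Andrews, R. Askey, R. Roy, *Special Functions*, CUP 1999, Thm. 1.5.1 (Legendre),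
  Thm. 1.5.2 (Gauss multiplication).
-/

noncomputable section

open scoped Real

namespace Literature.Analysis.SpecialFunctions

/-- `(Γ(1/12)·Γ(6/12)·Γ(8/12)·Γ(9/12))² = 4√2(√3+1)·3^{-1/4}·π⁴`.
[cite: Deligne1982HodgeCycles, I Thm. 7.15] [cite: AndrewsAskeyRoy1999, Thm 1.5.2] -/
theorem Real_Gamma_prod_fermat12_1_6_8_9_sq :
    (Real.Gamma (1 / 12) * Real.Gamma (6 / 12) * Real.Gamma (8 / 12) * Real.Gamma (9 / 12)) ^ 2 =
      4 * Real.sqrt 2 * (Real.sqrt 3 + 1) / (3 : ℝ) ^ ((1 : ℝ) / 4) * π ^ 4 := by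
  rw [show (6 / 12 : ℝ) = 1 / 2 by norm_num, show (8 / 12 : ℝ) = 2 / 3 by norm_num,
    show (9 / 12 : ℝ) = 3 / 4 by norm_num, Real.Gamma_one_half_eq]
  have hsp : Real.sqrt π ^ 2 = π := Real.sq_sqrt Real.pi_pos.le
  have hR3 := Real.Gamma_mul_Gamma_one_sub (1 / 4 : ℝ)
  rw [show (1 : ℝ) - 1 / 4 = 3 / 4 by norm_num, show π * (1 / 4 : ℝ) = π / 4 by ring,
    Real.sin_pi_div_four] at hR3
  have hR4 := Real.Gamma_mul_Gamma_one_sub (1 / 3 : ℝ)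
  rw [show (1 : ℝ) - 1 / 3 = 2 / 3 by norm_num, show π * (1 / 3 : ℝ) = π / 3 by ring,
    Real.sin_pi_div_three] at hR4
  have hR5 := Real.Gamma_mul_Gamma_one_sub (5 / 12 : ℝ)
  rw [show (1 : ℝ) - 5 / 12 = 7 / 12 by norm_num, show π * (5 / 12 : ℝ) = π / 4 + π / 6 by ring,
    Real.sin_add, Real.sin_pi_div_four, Real.cos_pi_div_six, Real.cos_pi_div_four,
    Real.sin_pi_div_six] at hR5
  have hD21 := Real.Gamma_mul_Gamma_add_half (1 / 12 : ℝ)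
  rw [show (1 : ℝ) - 2 * (1 / 12) = 5 / 6 by norm_num, show (2 : ℝ) * (1 / 12) = 1 / 6 by norm_num,
    show (1 / 12 : ℝ) + 1 / 2 = 7 / 12 by norm_num] at hD21
  have hD22 := Real.Gamma_mul_Gamma_add_half (1 / 6 : ℝ)
  rw [show (1 : ℝ) - 2 * (1 / 6) = 2 / 3 by norm_num, show (2 : ℝ) * (1 / 6) = 1 / 3 by norm_num,
    show (1 / 6 : ℝ) + 1 / 2 = 2 / 3 by norm_num] at hD22
  have h2 : (2 : ℝ) ^ ((5 : ℝ) / 6) * (2 : ℝ) ^ ((2 : ℝ) / 3) = 2 * Real.sqrt 2 := by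
    rw [← Real.rpow_add (by norm_num : (0 : ℝ) < 2), show ((5 : ℝ) / 6 + (2 : ℝ) / 3) = 1 + 1 / 2 by norm_num,
      Real.rpow_add (by norm_num : (0 : ℝ) < 2), Real.rpow_one, ← Real.sqrt_eq_rpow]
  -- the two duplications multiply to a √π-free identity
  have hDD : (Real.Gamma (1 / 12) * Real.Gamma (7 / 12)) * (Real.Gamma (1 / 6) * Real.Gamma (2 / 3)) =
      Real.Gamma (1 / 6) * Real.Gamma (1 / 3) * (2 * Real.sqrt 2) * π := by
    rw [hD21, hD22, ← h2]
    linear_combination (Real.Gamma (1 / 6) * Real.Gamma (1 / 3) * (2 : ℝ) ^ ((5 : ℝ) / 6) *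
      (2 : ℝ) ^ ((2 : ℝ) / 3)) * hsp
  have h3 := GaussMultiplication.real_formula (n := 3) (by norm_num) (show (0 : ℝ) < 1 / 12 by norm_num)
  simp only [GaussMultiplication.prodGamma, Finset.prod_range_succ, Finset.prod_range_zero, one_mul,
    Nat.cast_zero, Nat.cast_one, Nat.cast_ofNat, zero_div, add_zero] at h3
  norm_num at h3
  have hF := (Real.Gamma_pos_of_pos (by norm_num : (0 : ℝ) < 1 / 6)).ne'
  have hK := (Real.Gamma_pos_of_pos (by norm_num : (0 : ℝ) < 1 / 3)).ne'
  have hG := (Real.Gamma_pos_of_pos (by norm_num : (0 : ℝ) < 1 / 4)).ne'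
  have ht : (3 : ℝ) ^ ((1 : ℝ) / 4) ≠ 0 := (Real.rpow_pos_of_pos (by norm_num) _).ne'
  set A := Real.Gamma (1 / 12) with hA
  set B := Real.Gamma (5 / 12) with hB'
  set C := Real.Gamma (3 / 4) with hC
  set E := Real.Gamma (7 / 12) with hE'
  set F := Real.Gamma (1 / 6) with hF'
  set G := Real.Gamma (1 / 4) with hG'
  set H := Real.Gamma (2 / 3) with hH
  set K := Real.Gamma (1 / 3) with hK'
  set t := (3 : ℝ) ^ ((1 : ℝ) / 4) with ht'
  have hP : (A * Real.sqrt π * H * C) ^ 2 = π * (A * H * C) ^ 2 := by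
    simp only [mul_pow, hsp]; ring
  rw [hP]
  have key : (A * H * C) ^ 2 * ((B * E) * F * K * G * t) =
      (G * C) * (K * H) * ((A * E) * (F * H)) * (A * B * C * t) := by ring
  rw [hR5, hR3, hR4, hDD, h3] at key
  have hX : (π / (Real.sqrt 2 / 2 * (Real.sqrt 3 / 2) + Real.sqrt 2 / 2 * (1 / 2))) * F * K * G * t ≠ 0 := by
    positivity
  rw [eq_div_of_mul_eq hX key]
  field_simp
  ring

/-- Normalised form: with `Γ̃ = −P/(4π²)`, `Γ̃² = √2(√3+1)/(4·3^{1/4})`.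
[cite: Deligne1982HodgeCycles, I Thm. 7.15] -/
theorem gammaTilde_fermat12_1_6_8_9_sq :
    (Real.Gamma (1 / 12) * Real.Gamma (6 / 12) * Real.Gamma (8 / 12) * Real.Gamma (9 / 12) /
        (4 * π ^ 2)) ^ 2 =
      Real.sqrt 2 * (Real.sqrt 3 + 1) / (4 * (3 : ℝ) ^ ((1 : ℝ) / 4)) := by
  have h := Real_Gamma_prod_fermat12_1_6_8_9_sq
  have ht : (3 : ℝ) ^ ((1 : ℝ) / 4) ≠ 0 := (Real.rpow_pos_of_pos (by norm_num) _).ne'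
  have hpi : π ≠ 0 := Real.pi_pos.ne'
  rw [div_pow, h]
  field_simp

/-- The degree-8 polynomial `48 x⁸ − 24 x⁴ − 1` vanishes at `x = Γ̃(1,6,8,9) = P/(4π²)` up to sign
(found as the exact minimal polynomial by PARI in the pub-hlocus engine A; irreducibility not asserted).
[cite: Deligne1982HodgeCycles, I Thm. 7.15] -/
theorem gammaTilde_fermat12_1_6_8_9_minpoly :
    let x := Real.Gamma (1 / 12) * Real.Gamma (6 / 12) * Real.Gamma (8 / 12) * Real.Gamma (9 / 12) /
        (4 * π ^ 2)
    48 * x ^ 8 - 24 * x ^ 4 - 1 = 0 := by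
  intro x
  have hv : x ^ 2 = Real.sqrt 2 * (Real.sqrt 3 + 1) / (4 * (3 : ℝ) ^ ((1 : ℝ) / 4)) :=
    gammaTilde_fermat12_1_6_8_9_sq
  have hs2 : Real.sqrt 2 ^ 2 = 2 := Real.sq_sqrt (by norm_num)
  have hs3 : Real.sqrt 3 ^ 2 = 3 := Real.sq_sqrt (by norm_num)
  have ht2 : ((3 : ℝ) ^ ((1 : ℝ) / 4)) ^ 2 = Real.sqrt 3 := by
    rw [← Real.rpow_natCast, ← Real.rpow_mul (by norm_num : (0 : ℝ) ≤ 3), Real.sqrt_eq_rpow]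
    norm_num
  have ht : (3 : ℝ) ^ ((1 : ℝ) / 4) ≠ 0 := (Real.rpow_pos_of_pos (by norm_num) _).ne'
  have hs3ne : Real.sqrt 3 ≠ 0 := (Real.sqrt_pos.mpr (by norm_num : (0:ℝ) < 3)).ne'
  set t := (3 : ℝ) ^ ((1 : ℝ) / 4) with ht'
  -- x⁴ = (x²)² = 2 (√3+1)² / (16 t²) = (2 + √3)/(4 √3)
  have hx4 : x ^ 4 = (2 + Real.sqrt 3) / (4 * Real.sqrt 3) := by
    rw [show x ^ 4 = (x ^ 2) ^ 2 by ring, hv, div_pow, mul_pow, mul_pow, hs2, ht2]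
    field_simp
    linear_combination 2 * hs3
  rw [show x ^ 8 = (x ^ 4) ^ 2 by ring, hx4]
  field_simp
  linear_combination (-64) * hs3

/-- The sign: in `ℂ`, `Γ(1/12)Γ(6/12)Γ(8/12)Γ(9/12) / (2πi)² = −√(√2(√3+1)/(4·3^{1/4})) < 0`.
[cite: Deligne1982HodgeCycles, I Thm. 7.15] -/
theorem Complex_gammaTilde_fermat12_1_6_8_9 :
    ((Real.Gamma (1 / 12) * Real.Gamma (6 / 12) * Real.Gamma (8 / 12) * Real.Gamma (9 / 12) : ℝ) : ℂ) /
        (2 * π * Complex.I) ^ 2 =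
      -(Real.sqrt (Real.sqrt 2 * (Real.sqrt 3 + 1) / (4 * (3 : ℝ) ^ ((1 : ℝ) / 4))) : ℝ) := by
  set P := Real.Gamma (1 / 12) * Real.Gamma (6 / 12) * Real.Gamma (8 / 12) * Real.Gamma (9 / 12)
    with hP
  have hPpos : 0 < P := by
    simp only [hP]
    have := Real.Gamma_pos_of_pos (by norm_num : (0 : ℝ) < 1 / 12)
    have := Real.Gamma_pos_of_pos (by norm_num : (0 : ℝ) < 6 / 12)
    have := Real.Gamma_pos_of_pos (by norm_num : (0 : ℝ) < 8 / 12)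
    have := Real.Gamma_pos_of_pos (by norm_num : (0 : ℝ) < 9 / 12)
    positivity
  have hsq : Real.sqrt (Real.sqrt 2 * (Real.sqrt 3 + 1) / (4 * (3 : ℝ) ^ ((1 : ℝ) / 4))) =
      P / (4 * π ^ 2) := by
    rw [← gammaTilde_fermat12_1_6_8_9_sq, Real.sqrt_sq (by positivity)]
  rw [hsq]
  have hden : (2 * (π : ℂ) * Complex.I) ^ 2 = -(4 * (π : ℂ) ^ 2) := by
    linear_combination (4 * (π : ℂ) ^ 2) * Complex.I_sq
  have hpi : (π : ℂ) ≠ 0 := Complex.ofReal_ne_zero.mpr Real.pi_pos.ne'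
  rw [hden]
  push_cast
  field_simp

end Literature.Analysis.SpecialFunctions
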